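import Summits.Ventures.HodgeRepro2.T5CartanSU11

/-!
# T5PoincareDensity — the Möbius action of `SU(1,1)` on the unit disc and the pointwise
invariance of the Poincaré density, kernel-checked

Support for `route/T5-N4-p5.md` (sub-step N4.3 = (R3)), steps (N4.3.P1)/(N4.3.P2′)/(N4.3.P3): the
convergence integrals there are taken against the Haar measure of `H_j¹ = SU(1,1)` in Cartan
coordinates — Rühl's `½ sinh η dη (4π)⁻² dψ₁ dψ₂` (R3.10), i.e. the density `sinh(2t) dt` on
`K\G/K` used in the ε-neighbourhood bound (`T5CoshIntegral.epsilon_bound_integral`).  The honest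
scope of the earlier annex files lists «the Haar measure of `U(1,1)` in Cartan coordinates» as NOT
formalised.  This file supplies its ALGEBRAIC heart: `SU(1,1) = {!![a, b; conj b, conj a] :
‖a‖² − ‖b‖² = 1}` acts on the unit disc `𝔻 = {‖z‖ < 1}` by `z ↦ (az + b)/(b̄z + ā)`, and the
Poincaré density `(1 − ‖z‖²)⁻²` is invariant under this action pointwise (the Jacobian identity).

* `mobius g z = (g₀₀ z + g₀₁)/(g₁₀ z + g₁₁)`; `mobius_mul` (the composition law, when the
  denominators do not vanish);
* `normSq_denom_sub_normSq_num`: `‖b̄z + ā‖² − ‖az + b‖² = (‖a‖² − ‖b‖²)(1 − ‖z‖²)` — the key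
  identity;
* `denom_ne_zero`, `normSq_mobius_lt_one`, `one_sub_normSq_mobius`: for `‖a‖² − ‖b‖² = 1` and
  `‖z‖ < 1` the denominator does not vanish, `g · z ∈ 𝔻`, and
  `1 − ‖g·z‖² = (1 − ‖z‖²)/‖b̄z + ā‖²`;
* `mobius_mul_of_memU11_det_one`: the composition law on `𝔻` for `SU(1,1)` (a group action);
* `hasDerivAt_mobius` (`(g·z)′ = det g/(g₁₀ z + g₁₁)²`), `hasDerivAt_mobius_su11`
  (`= 1/(b̄z + ā)²`);
* `density_invariance`: `‖(g·z)′‖² · (1 − ‖g·z‖²)⁻² = (1 − ‖z‖²)⁻²` — the Poincaré area form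
  `dA/(1 − ‖z‖²)²` is `SU(1,1)`-invariant (pointwise Jacobian identity);
* `mobius_hyperbolicC_zero` (`a_t · 0 = tanh t`), `mobius_diag` (`diag(u, ū) · z = u² z` for
  `‖u‖ = 1`), `mobius_cartan_zero` (`k(α) a_t k(β) · 0 = α² tanh t` — the Cartan coordinates
  `(θ, t) ↦ e^{2iθ} tanh t` of the orbit of `0 = eK`, `K = SO(2)` the stabiliser).

Honest scope: the statements are pointwise (algebra and one derivative); the MEASURE statement
«the pushforward of Haar measure on `G` to `G/K = 𝔻` is a multiple of the Poincaré measure» (uniqueness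
of invariant measures) and the resulting Cartan-coordinate formula for Haar measure are NOT
formalised here.
-/

noncomputable section

namespace Summit.Ventures.HodgeRepro2.T5PoincareDensity

open Complex
open scoped ComplexConjugate

/-- The Möbius action of a complex `2 × 2` matrix: `g · z = (g₀₀ z + g₀₁)/(g₁₀ z + g₁₁)`. -/
def mobius (g : Matrix (Fin 2) (Fin 2) ℂ) (z : ℂ) : ℂ :=
  (g 0 0 * z + g 0 1) / (g 1 0 * z + g 1 1)

/-- The denominator `g₁₀ z + g₁₁` of `g · z`. -/
def denom (g : Matrix (Fin 2) (Fin 2) ℂ) (z : ℂ) : ℂ := g 1 0 * z + g 1 1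

/-- `g · z = (g₀₀ z + g₀₁) / denom g z`. -/
theorem mobius_eq (g : Matrix (Fin 2) (Fin 2) ℂ) (z : ℂ) :
    mobius g z = (g 0 0 * z + g 0 1) / denom g z := rfl

/-- The composition law `(AB) · z = A · (B · z)` whenever the two denominators do not vanish. -/
theorem mobius_mul (A B : Matrix (Fin 2) (Fin 2) ℂ) (z : ℂ) (hB : denom B z ≠ 0)
    (hAB : denom (A * B) z ≠ 0) : mobius (A * B) z = mobius A (mobius B z) := by
  unfold denom at hB
  have hAB' : (A 1 0 * B 0 0 + A 1 1 * B 1 0) * z + (A 1 0 * B 0 1 + A 1 1 * B 1 1) ≠ 0 := by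
    intro h0; apply hAB
    simp only [denom, Matrix.mul_apply, Fin.sum_univ_two]
    exact h0
  have h2 : A 1 0 * ((B 0 0 * z + B 0 1) / (B 1 0 * z + B 1 1)) + A 1 1 ≠ 0 := by
    have : A 1 0 * ((B 0 0 * z + B 0 1) / (B 1 0 * z + B 1 1)) + A 1 1 =
        ((A 1 0 * B 0 0 + A 1 1 * B 1 0) * z + (A 1 0 * B 0 1 + A 1 1 * B 1 1)) /
          (B 1 0 * z + B 1 1) := by
      rw [mul_div_assoc', div_add' _ _ _ hB]
      congr 1
      ring
    rw [this]
    exact div_ne_zero hAB' hB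
  simp only [mobius, Matrix.mul_apply, Fin.sum_univ_two]
  field_simp
  ring

/-- THE KEY IDENTITY: `‖b̄z + ā‖² − ‖az + b‖² = (‖a‖² − ‖b‖²)(1 − ‖z‖²)`. -/
theorem normSq_denom_sub_normSq_num (a b z : ℂ) :
    normSq (conj b * z + conj a) - normSq (a * z + b) = (normSq a - normSq b) * (1 - normSq z) := by
  simp only [normSq_apply, add_re, add_im, mul_re, mul_im, conj_re, conj_im]
  ring

/-- The matrix `!![a, b; conj b, conj a]` of `SU(1,1)` (when `‖a‖² − ‖b‖² = 1`). -/
def su11 (a b : ℂ) : Matrix (Fin 2) (Fin 2) ℂ := !![a, b; conj b, conj a]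

/-- `!![a, b; conj b, conj a] · z = (az + b)/(b̄z + ā)`. -/
theorem mobius_su11 (a b z : ℂ) : mobius (su11 a b) z = (a * z + b) / (conj b * z + conj a) := by
  simp [mobius, su11]

/-- The denominator of `!![a, b; conj b, conj a] · z` is `b̄z + ā`. -/
theorem denom_su11 (a b z : ℂ) : denom (su11 a b) z = conj b * z + conj a := by
  simp [denom, su11]

/-- For `‖a‖² − ‖b‖² = 1` and `‖z‖ < 1` the denominator `b̄z + ā` does not vanish. -/
theorem denom_ne_zero {a b z : ℂ} (h : normSq a - normSq b = 1) (hz : normSq z < 1) :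
    conj b * z + conj a ≠ 0 := by
  intro h0
  have key := normSq_denom_sub_normSq_num a b z
  rw [h0, normSq_zero, h, one_mul] at key
  have := normSq_nonneg (a * z + b)
  linarith

/-- `1 − ‖g·z‖² = (1 − ‖z‖²)/‖b̄z + ā‖²` for `g = !![a, b; conj b, conj a] ∈ SU(1,1)`. -/
theorem one_sub_normSq_mobius {a b z : ℂ} (h : normSq a - normSq b = 1) (hz : normSq z < 1) :
    1 - normSq (mobius (su11 a b) z) = (1 - normSq z) / normSq (conj b * z + conj a) := by
  have hd := denom_ne_zero h hz
  have hd' : normSq (conj b * z + conj a) ≠ 0 := by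
    intro h0; exact hd (normSq_eq_zero.mp h0)
  have key := normSq_denom_sub_normSq_num a b z
  rw [h, one_mul] at key
  rw [mobius_su11, normSq_div, eq_div_iff hd', sub_mul, div_mul_cancel₀ _ hd', one_mul]
  linear_combination key

/-- `SU(1,1)` preserves the unit disc. -/
theorem normSq_mobius_lt_one {a b z : ℂ} (h : normSq a - normSq b = 1) (hz : normSq z < 1) :
    normSq (mobius (su11 a b) z) < 1 := by
  have hd := denom_ne_zero h hz
  have hpos : 0 < normSq (conj b * z + conj a) := normSq_pos.mpr hd
  have := one_sub_normSq_mobius h hz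
  have hq : 0 < (1 - normSq z) / normSq (conj b * z + conj a) := by
    apply div_pos (by linarith) hpos
  linarith

/-- The entries of an element of `SU(1,1)`: `g = !![a, b; conj b, conj a]` with `a = g 0 0`,
`b = g 0 1`. -/
theorem eq_su11_of_memU11_det_one {g : Matrix (Fin 2) (Fin 2) ℂ}
    (hg : T5UnitaryBound.MemU11 g) (hd : g.det = 1) : g = su11 (g 0 0) (g 0 1) := by
  have h11 := T5CartanSU11.entry_11_eq_conj_00 hg hd
  have h10 := T5CartanSU11.entry_10_eq_conj_01 hg hd
  ext i j
  fin_cases i <;> fin_cases j <;> simp [su11, h11, h10]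

/-- `‖g 0 0‖² − ‖g 0 1‖² = 1` on `SU(1,1)`. -/
theorem normSq_sub_normSq_of_memU11_det_one {g : Matrix (Fin 2) (Fin 2) ℂ}
    (hg : T5UnitaryBound.MemU11 g) (hd : g.det = 1) : normSq (g 0 0) - normSq (g 0 1) = 1 := by
  have hform := eq_su11_of_memU11_det_one hg hd
  have : (su11 (g 0 0) (g 0 1)).det = ((normSq (g 0 0) - normSq (g 0 1) : ℝ) : ℂ) := by
    simp only [su11, Matrix.det_fin_two_of, Complex.mul_conj]
    push_cast; ring
  rw [← hform, hd] at this
  exact_mod_cast this.symm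

/-- `SU(1,1)` is closed under products (`T5CartanU11.memU11_mul` + `det_mul`). -/
theorem memU11_det_one_mul {A B : Matrix (Fin 2) (Fin 2) ℂ}
    (hA : T5UnitaryBound.MemU11 A) (hdA : A.det = 1)
    (hB : T5UnitaryBound.MemU11 B) (hdB : B.det = 1) :
    T5UnitaryBound.MemU11 (A * B) ∧ (A * B).det = 1 :=
  ⟨T5CartanU11.memU11_mul hA hB, by rw [Matrix.det_mul, hdA, hdB, one_mul]⟩

/-- The denominator of `g · z` does not vanish on the disc, for `g ∈ SU(1,1)`. -/
theorem denom_ne_zero_of_memU11_det_one {g : Matrix (Fin 2) (Fin 2) ℂ}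
    (hg : T5UnitaryBound.MemU11 g) (hd : g.det = 1) {z : ℂ} (hz : normSq z < 1) :
    denom g z ≠ 0 := by
  rw [eq_su11_of_memU11_det_one hg hd, denom_su11]
  exact denom_ne_zero (normSq_sub_normSq_of_memU11_det_one hg hd) hz

/-- THE GROUP ACTION: `(AB) · z = A · (B · z)` on the disc, for `A, B ∈ SU(1,1)`. -/
theorem mobius_mul_of_memU11_det_one {A B : Matrix (Fin 2) (Fin 2) ℂ}
    (hA : T5UnitaryBound.MemU11 A) (hdA : A.det = 1)
    (hB : T5UnitaryBound.MemU11 B) (hdB : B.det = 1) {z : ℂ} (hz : normSq z < 1) :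
    mobius (A * B) z = mobius A (mobius B z) := by
  obtain ⟨hAB, hdAB⟩ := memU11_det_one_mul hA hdA hB hdB
  exact mobius_mul A B z (denom_ne_zero_of_memU11_det_one hB hdB hz)
    (denom_ne_zero_of_memU11_det_one hAB hdAB hz)

/-- `SU(1,1)` preserves the disc (matrix form). -/
theorem normSq_mobius_lt_one_of_memU11_det_one {g : Matrix (Fin 2) (Fin 2) ℂ}
    (hg : T5UnitaryBound.MemU11 g) (hd : g.det = 1) {z : ℂ} (hz : normSq z < 1) :
    normSq (mobius g z) < 1 := by
  rw [eq_su11_of_memU11_det_one hg hd]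
  exact normSq_mobius_lt_one (normSq_sub_normSq_of_memU11_det_one hg hd) hz

/-- The derivative of `z ↦ g · z` is `det g / (g₁₀ z + g₁₁)²`. -/
theorem hasDerivAt_mobius (g : Matrix (Fin 2) (Fin 2) ℂ) {z : ℂ} (hd : denom g z ≠ 0) :
    HasDerivAt (mobius g) (g.det / (denom g z) ^ 2) z := by
  unfold denom at hd
  have h1 : HasDerivAt (fun w : ℂ => g 0 0 * w + g 0 1) (g 0 0) z := by
    simpa using ((hasDerivAt_id z).const_mul (g 0 0)).add_const (g 0 1)
  have h2 : HasDerivAt (fun w : ℂ => g 1 0 * w + g 1 1) (g 1 0) z := by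
    simpa using ((hasDerivAt_id z).const_mul (g 1 0)).add_const (g 1 1)
  have e : mobius g = (fun w : ℂ => g 0 0 * w + g 0 1) / (fun w : ℂ => g 1 0 * w + g 1 1) := by
    funext w; rfl
  rw [e]
  refine (h1.div h2 hd).congr_deriv ?_
  rw [Matrix.det_fin_two]
  unfold denom
  ring

/-- On `SU(1,1)` the derivative is `1/(b̄z + ā)²`. -/
theorem hasDerivAt_mobius_su11 {a b : ℂ} (h : normSq a - normSq b = 1) {z : ℂ}
    (hz : normSq z < 1) :
    HasDerivAt (mobius (su11 a b)) (1 / (conj b * z + conj a) ^ 2) z := by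
  have hd : denom (su11 a b) z ≠ 0 := by rw [denom_su11]; exact denom_ne_zero h hz
  have := hasDerivAt_mobius (su11 a b) hd
  have hdet : (su11 a b).det = 1 := by
    simp only [su11, Matrix.det_fin_two_of, Complex.mul_conj]
    have : ((normSq a - normSq b : ℝ) : ℂ) = 1 := by rw [h]; simp
    push_cast at this
    linear_combination this
  rwa [hdet, denom_su11] at this

/-- POINTWISE INVARIANCE OF THE POINCARÉ DENSITY: for `g ∈ SU(1,1)` and `z ∈ 𝔻`,
`‖(g·z)′‖² / (1 − ‖g·z‖²)² = 1 / (1 − ‖z‖²)²`. -/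
theorem density_invariance {a b : ℂ} (h : normSq a - normSq b = 1) {z : ℂ} (hz : normSq z < 1) :
    normSq (1 / (conj b * z + conj a) ^ 2) / (1 - normSq (mobius (su11 a b) z)) ^ 2 =
      1 / (1 - normSq z) ^ 2 := by
  have hd := denom_ne_zero h hz
  have hd' : normSq (conj b * z + conj a) ≠ 0 := by
    intro h0; exact hd (normSq_eq_zero.mp h0)
  have hz' : 1 - normSq z ≠ 0 := by linarith
  rw [one_sub_normSq_mobius h hz, normSq_div, normSq_one, map_pow]
  field_simp

/-- `a_t · 0 = tanh t` for the hyperbolic element `a_t = !![cosh t, sinh t; sinh t, cosh t]`. -/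
theorem mobius_hyperbolicC_zero (t : ℝ) :
    mobius (T5UnitaryBound.hyperbolicC t) 0 = (Real.tanh t : ℂ) := by
  simp [mobius, T5UnitaryBound.hyperbolicC, Real.tanh_eq_sinh_div_cosh]

/-- `diag(u, ū) · z = u² z` for a unit `u` — the torus `K_W ∩ SU(1,1)` rotates the disc by `u²`. -/
theorem mobius_diag {u : ℂ} (hu : ‖u‖ = 1) (z : ℂ) :
    mobius !![u, 0; 0, conj u] z = u ^ 2 * z := by
  have hu' : conj u * u = 1 := by
    rw [mul_comm, Complex.mul_conj, Complex.normSq_eq_norm_sq, hu]; simp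
  have hne : conj u ≠ 0 := by
    intro h0; rw [h0, zero_mul] at hu'; exact zero_ne_one hu'
  simp only [mobius]
  simp
  rw [div_eq_iff hne]
  linear_combination (-(u * z)) * hu'

/-- CARTAN COORDINATES OF THE ORBIT OF `0`: `k(α) a_t k(β) · 0 = α² tanh t` for unit `α`, `β` —
the map `(θ, t) ↦ e^{2iθ} tanh t` of `SO(2) × A⁺` onto the disc, the stabiliser of `0` being
`K = SO(2)` (`mobius_diag` with `z = 0`). -/
theorem mobius_cartan_zero {α β : ℂ} (hα : ‖α‖ = 1) (hβ : ‖β‖ = 1) (t : ℝ) :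
    mobius (!![α, 0; 0, conj α] * T5UnitaryBound.hyperbolicC t * !![β, 0; 0, conj β]) 0 =
      α ^ 2 * (Real.tanh t : ℂ) := by
  have hα' : conj α * α = 1 := by
    rw [mul_comm, Complex.mul_conj, Complex.normSq_eq_norm_sq, hα]; simp
  have hβ' : conj β * β = 1 := by
    rw [mul_comm, Complex.mul_conj, Complex.normSq_eq_norm_sq, hβ]; simp
  have hαne : conj α ≠ 0 := by
    intro h0; rw [h0, zero_mul] at hα'; exact zero_ne_one hα'
  have hβne : conj β ≠ 0 := by
    intro h0; rw [h0, zero_mul] at hβ'; exact zero_ne_one hβ'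
  have hc : (Real.cosh t : ℂ) ≠ 0 := by
    exact_mod_cast (Real.cosh_pos t).ne'
  set M := !![α, 0; 0, conj α] * T5UnitaryBound.hyperbolicC t * !![β, 0; 0, conj β] with hM
  have hM01 : M 0 1 = α * (Real.sinh t : ℂ) * conj β := by
    simp [hM, T5UnitaryBound.hyperbolicC]
  have hM11 : M 1 1 = conj α * (Real.cosh t : ℂ) * conj β := by
    simp [hM, T5UnitaryBound.hyperbolicC]
  have hden : conj α * (Real.cosh t : ℂ) * conj β ≠ 0 := mul_ne_zero (mul_ne_zero hαne hc) hβne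
  rw [mobius, hM01, hM11, mul_zero, zero_add, mul_zero, zero_add, Real.tanh_eq_sinh_div_cosh,
    Complex.ofReal_div, ← mul_div_assoc, div_eq_div_iff hden hc]
  linear_combination (-(α * (Real.sinh t : ℂ) * conj β * (Real.cosh t : ℂ))) * hα'

end Summit.Ventures.HodgeRepro2.T5PoincareDensity

end
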